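import Summits.Langlands.Langlands.Theorems.IrreducibilityBySelfDualityIrreducibleOffSectorSymmPowerForms
import Summits.Langlands.Langlands.Theorems.IrreducibilityBySelfDualityIrreducibleOffSectorTensorProduct
import Mathlib.Topology.Algebra.MvPolynomial
import Mathlib.Topology.Instances.Matrix
import Mathlib.LinearAlgebra.Matrix.GeneralLinearGroup.Defs
import HarnessLib

/-!
# Symmetric powers of framed representations and their Frobenius polynomials
(crux stmt-Langlands-14329 `IrreducibilityBySelfDuality.IrreducibleOffSector`, line `Sketch`;
`--supports` file, STRUCTURAL: no import of the route module; continuation lead c6)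

Galois-side engine, part 2, of the SYMMETRIC-POWER ASCENT operator for the crux
(`…IrreducibleOffSectorSymmPowerAscent`): the `m`-th symmetric power `Sym^m ρ : G →ₜ* GL_{m+1}(A)` of
a framed continuous representation `ρ : G →ₜ* GL_2(A)` and its characteristic polynomials, on top of
the binary-form matrices `S g` of part 1 (`…SymmPowerForms`: `S_mul`, `S_one`, `charpoly_S_eq_prod`).
No definition is introduced: the symmetric power is packaged existentially (`exists_symmPowerGL`,
`exists_symmPower`), and every statement is about ANY `ρ_m` whose matrices have the binary-form
entries `(ρ_m g)_{ij} = coeff_{(m-i,i)} (X_0^{m-j} X_1^{j} ∘ ρ(g))` (so it applies verbatim to a future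
Literature definition).

* §6 `S_map`, `continuous_S` — the entries of `S g` are universal integer polynomials in the entries
  of `g` (base change along ring homomorphisms; evaluation of the generic matrix), hence `g ↦ S g` is
  continuous over a topological ring (Mathlib `MvPolynomial.continuous_eval`);
* §7 `exists_symmPowerGL` — `Sym^m : GL_2(R) →ₜ* GL_{m+1}(R)` exists (Mathlib `Units.map`,
  `Units.continuous_iff`); `charpoly_symmPowerGL_eq_prod`;
* §8 `exists_symmPower`, `symmPower_apply_eq_one`, `charpoly_symmPower_eq_prod` — framed
  representations: `Sym^m ρ` exists, is trivial where `ρ` is, and over a field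
  `χ_{ρ(g)} = (X - a)(X - b) ⟹ χ_{(Sym^m ρ)(g)} = ∏_{j=0}^{m} (X - a^{m-j} b^{j})`;
* §9 `isUnramifiedAt_symmPower`, `hasFrobCharpolyAt_symmPower` — unramified where `ρ` is; Frobenius
  polynomials are symmetric powers root-wise;
* §10 `arithFrobPolyOfSatake_one_pair`, `arithFrobPolyOfSatake_one_symmPower`,
  `hasFrobCharpolyAt_symmPower_arithFrobPolyOfSatake` — the dictionary `a ↦ ι⁻¹(a⁻¹)` is
  multiplicative, so avatars compatible with the Satake pair `{x, y}` have symmetric powers compatible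
  with `Sym^m {x, y} = {x^{m-j} y^{j} : 0 ≤ j ≤ m}` (unramified local symmetric-power functoriality
  `GL_2 → GL_{m+1}` on the Galois side).

References: J.-P. Serre, *Linear representations of finite groups* (1977), §1.5–1.6; W. Fulton,
J. Harris, *Representation Theory* (1991), §11.1; J.-P. Serre, *Abelian ℓ-adic representations and
elliptic curves* (1968), Ch. I §2.1; K. Buzzard, T. Gee, LMS LNS 414 (2014), §2.1.
-/

noncomputable section

set_option linter.dupNamespace false

open scoped Polynomial MatrixGroups
open MvPolynomial Finsupp

namespace Summit.Langlands.Langlands.Theorems.IrreducibleOffSector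

namespace SymmPower

/-! ## 6. Base change and continuity -/

section BaseChange

variable {A B : Type*} [CommRing A] [CommRing B] {m : ℕ}
  {SA : Matrix (Fin 2) (Fin 2) A → Matrix (Fin (m + 1)) (Fin (m + 1)) A}
  {SB : Matrix (Fin 2) (Fin 2) B → Matrix (Fin (m + 1)) (Fin (m + 1)) B}

/-- **The symmetric power commutes with ring homomorphisms**: `S (f g) = f (S g)` entrywise
(its entries are universal integer polynomials in the entries of `g`). [folklore] -/
theorem S_map
    (hSA : ∀ g i j, SA g i j = coeff (single 0 (m - i) + single 1 (i : ℕ))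
      (bind₁ (fun i : Fin 2 => ∑ k : Fin 2, C (g k i) * X k) (X 0 ^ (m - j) * X 1 ^ (j : ℕ))))
    (hSB : ∀ g i j, SB g i j = coeff (single 0 (m - i) + single 1 (i : ℕ))
      (bind₁ (fun i : Fin 2 => ∑ k : Fin 2, C (g k i) * X k) (X 0 ^ (m - j) * X 1 ^ (j : ℕ))))
    (f : A →+* B) (g : Matrix (Fin 2) (Fin 2) A) : SB (g.map f) = (SA g).map f := by
  ext i j
  rw [Matrix.map_apply, hSB, hSA, ← coeff_map, map_bind₁]
  simp only [Matrix.map_apply, map_sum, map_mul, map_C, map_X, map_pow]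

end BaseChange

section Continuity

variable {R : Type*} [CommRing R] [TopologicalSpace R] [IsTopologicalRing R] {m : ℕ}
  {S : Matrix (Fin 2) (Fin 2) R → Matrix (Fin (m + 1)) (Fin (m + 1)) R}

/-- **`g ↦ S g` is continuous** over a topological ring: by `S_map` applied to the evaluation of
the generic matrix, each entry of `S g` is the evaluation at the entries of `g` of a fixed integer
polynomial (`MvPolynomial.continuous_eval`). [folklore] -/
theorem continuous_S
    (hS : ∀ g i j, S g i j = coeff (single 0 (m - i) + single 1 (i : ℕ))
      (bind₁ (fun i : Fin 2 => ∑ k : Fin 2, C (g k i) * X k) (X 0 ^ (m - j) * X 1 ^ (j : ℕ)))) :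
    Continuous S := by
  classical
  -- the universal symmetric power over `ℤ[x_{kl}]` at the generic matrix
  let U := MvPolynomial (Fin 2 × Fin 2) ℤ
  let SU : Matrix (Fin 2) (Fin 2) U → Matrix (Fin (m + 1)) (Fin (m + 1)) U := fun g =>
    Matrix.of fun i j => coeff (single 0 (m - i) + single 1 (i : ℕ))
      (bind₁ (fun i : Fin 2 => ∑ k : Fin 2, C (g k i) * X k) (X 0 ^ (m - j) * X 1 ^ (j : ℕ)))
  have hSU : ∀ g i j, SU g i j = coeff (single 0 (m - i) + single 1 (i : ℕ))
      (bind₁ (fun i : Fin 2 => ∑ k : Fin 2, C (g k i) * X k) (X 0 ^ (m - j) * X 1 ^ (j : ℕ))) :=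
    fun _ _ _ => rfl
  let G : Matrix (Fin 2) (Fin 2) U := Matrix.of fun k l => X (k, l)
  have hev : ∀ g : Matrix (Fin 2) (Fin 2) R,
      S g = (SU G).map (eval₂Hom (Int.castRingHom R) fun kl => g kl.1 kl.2) := by
    intro g
    rw [← S_map hSU hS]
    congr 1
    ext k l
    simp only [G, Matrix.map_apply, Matrix.of_apply]
    exact (eval₂Hom_X' (Int.castRingHom R) (fun kl : Fin 2 × Fin 2 => g kl.1 kl.2) (k, l)).symm
  refine continuous_matrix fun i j => ?_
  have e : (fun g : Matrix (Fin 2) (Fin 2) R => S g i j) = fun g =>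
      eval (fun kl : Fin 2 × Fin 2 => g kl.1 kl.2) (map (Int.castRingHom R) (SU G i j)) := by
    funext g
    rw [hev g, Matrix.map_apply, coe_eval₂Hom, eval₂_eq_eval_map]
  rw [e]
  exact (MvPolynomial.continuous_eval _).comp
    (continuous_pi fun kl : Fin 2 × Fin 2 => continuous_id.matrix_elem kl.1 kl.2)

end Continuity

end SymmPower

/-! ## 7. Packaging: the symmetric power as a continuous homomorphism `GL_2 → GL_{m+1}` -/

section Package

open SymmPower

variable (R : Type*) [CommRing R] [TopologicalSpace R] [IsTopologicalRing R] (m : ℕ)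

/-- **The `m`-th symmetric power `Sym^m : GL_2(R) →ₜ* GL_{m+1}(R)` exists** (existential
packaging, no definition): a continuous group homomorphism whose matrix entries are given by the
binary-form formula `(Sym^m g)_{ij} = coeff_{(m-i,i)} (X_0^{m-j} X_1^{j} ∘ g)`,
`(P ∘ g)(X_0, X_1) = P((X_0, X_1) g)`.  Multiplicativity `S_mul`, unit `S_one`, continuity
`continuous_S` (inverse entries: `(Sym^m g)⁻¹ = Sym^m (g⁻¹)`). [folklore] -/
theorem exists_symmPowerGL :
    ∃ Φ : GL (Fin 2) R →ₜ* GL (Fin (m + 1)) R, ∀ (g : GL (Fin 2) R) (i j : Fin (m + 1)),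
      ((Φ g : GL (Fin (m + 1)) R) : Matrix (Fin (m + 1)) (Fin (m + 1)) R) i j =
        coeff (single 0 (m - i) + single 1 (i : ℕ))
          (bind₁ (fun i : Fin 2 => ∑ k : Fin 2,
              C (((g : GL (Fin 2) R) : Matrix (Fin 2) (Fin 2) R) k i) * X k)
            (X 0 ^ (m - j) * X 1 ^ (j : ℕ))) := by
  classical
  let S : Matrix (Fin 2) (Fin 2) R → Matrix (Fin (m + 1)) (Fin (m + 1)) R := fun g =>
    Matrix.of fun i j => coeff (single 0 (m - i) + single 1 (i : ℕ))
      (bind₁ (fun i : Fin 2 => ∑ k : Fin 2, C (g k i) * X k) (X 0 ^ (m - j) * X 1 ^ (j : ℕ)))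
  have hS : ∀ g i j, S g i j = coeff (single 0 (m - i) + single 1 (i : ℕ))
      (bind₁ (fun i : Fin 2 => ∑ k : Fin 2, C (g k i) * X k) (X 0 ^ (m - j) * X 1 ^ (j : ℕ))) :=
    fun _ _ _ => rfl
  let φ : Matrix (Fin 2) (Fin 2) R →* Matrix (Fin (m + 1)) (Fin (m + 1)) R :=
    { toFun := S, map_one' := S_one hS, map_mul' := S_mul hS }
  have hφ : Continuous φ := continuous_S hS
  refine ⟨⟨Units.map φ, Units.continuous_iff.2 ⟨?_, ?_⟩⟩, fun g i j => rfl⟩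
  · exact hφ.comp Units.continuous_val
  · exact (hφ.comp Units.continuous_coe_inv).congr fun u => rfl

/-- **Characteristic polynomial of `Sym^m g`** (over a topological field): for ANY map
`Φ : GL_2 → GL_{m+1}` with the binary-form entries of `exists_symmPowerGL` and `g ∈ GL_2(F)` with
`χ_g = (X - a)(X - b)`, `χ_{Φ g} = ∏_{j=0}^{m} (X - a^{m-j} b^{j})` (`charpoly_S_eq_prod`). [folklore] -/
theorem charpoly_symmPowerGL_eq_prod {F : Type*} [Field F] {m : ℕ}
    {Φ : GL (Fin 2) F → GL (Fin (m + 1)) F}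
    (hΦ : ∀ (g : GL (Fin 2) F) (i j : Fin (m + 1)),
      ((Φ g : GL (Fin (m + 1)) F) : Matrix (Fin (m + 1)) (Fin (m + 1)) F) i j =
        coeff (single 0 (m - i) + single 1 (i : ℕ))
          (bind₁ (fun i : Fin 2 => ∑ k : Fin 2,
              C (((g : GL (Fin 2) F) : Matrix (Fin 2) (Fin 2) F) k i) * X k)
            (X 0 ^ (m - j) * X 1 ^ (j : ℕ))))
    (g : GL (Fin 2) F) {a b : F}
    (hg : ((g : GL (Fin 2) F) : Matrix (Fin 2) (Fin 2) F).charpoly =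
      (Polynomial.X - Polynomial.C a) * (Polynomial.X - Polynomial.C b)) :
    ((Φ g : GL (Fin (m + 1)) F) : Matrix (Fin (m + 1)) (Fin (m + 1)) F).charpoly =
      ∏ j : Fin (m + 1), (Polynomial.X - Polynomial.C (a ^ (m - j) * b ^ (j : ℕ))) := by
  classical
  let S : Matrix (Fin 2) (Fin 2) F → Matrix (Fin (m + 1)) (Fin (m + 1)) F := fun g =>
    Matrix.of fun i j => coeff (single 0 (m - i) + single 1 (i : ℕ))
      (bind₁ (fun i : Fin 2 => ∑ k : Fin 2, C (g k i) * X k) (X 0 ^ (m - j) * X 1 ^ (j : ℕ)))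
  have hS : ∀ g i j, S g i j = coeff (single 0 (m - i) + single 1 (i : ℕ))
      (bind₁ (fun i : Fin 2 => ∑ k : Fin 2, C (g k i) * X k) (X 0 ^ (m - j) * X 1 ^ (j : ℕ))) :=
    fun _ _ _ => rfl
  have hΦS : ((Φ g : GL (Fin (m + 1)) F) : Matrix (Fin (m + 1)) (Fin (m + 1)) F) =
      S ((g : GL (Fin 2) F) : Matrix (Fin 2) (Fin 2) F) := by
    ext i j
    rw [hΦ, hS]
  rw [hΦS]
  exact charpoly_S_eq_prod hS _ hg

end Package

/-! ## 8. Symmetric powers of framed representations -/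

section Rep

open SymmPower Literature.NumberTheory.GaloisRepresentations

variable {G : Type*} [Group G] [TopologicalSpace G] {A : Type*} [CommRing A] [TopologicalSpace A]
  [IsTopologicalRing A] {m : ℕ}

/-- **The `m`-th symmetric power of a framed `2`-dimensional representation exists** (existential
packaging): for `ρ : G →ₜ* GL_2(A)` there is `Sym^m ρ : G →ₜ* GL_{m+1}(A)` whose matrices are the
binary-form matrices of `ρ(g)` (`exists_symmPowerGL` composed with `ρ`).
[cite: SerreLinearRepresentations1977, §1.5] -/
theorem exists_symmPower (ρ : FramedRep G A 2) :
    ∃ ρm : FramedRep G A (m + 1), ∀ (g : G) (i j : Fin (m + 1)),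
      ((ρm g : GL (Fin (m + 1)) A) : Matrix (Fin (m + 1)) (Fin (m + 1)) A) i j =
        coeff (single 0 (m - i) + single 1 (i : ℕ))
          (bind₁ (fun i : Fin 2 => ∑ k : Fin 2,
              C (((ρ g : GL (Fin 2) A) : Matrix (Fin 2) (Fin 2) A) k i) * X k)
            (X 0 ^ (m - j) * X 1 ^ (j : ℕ))) := by
  obtain ⟨Φ, hΦ⟩ := exists_symmPowerGL A m
  exact ⟨Φ.comp ρ, fun g i j => hΦ (ρ g) i j⟩

variable {ρ : FramedRep G A 2} {ρm : FramedRep G A (m + 1)}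

omit [IsTopologicalRing A] in
/-- `ρ g = 1 ⇒ (Sym^m ρ) g = 1` (`S_one`). [folklore] -/
theorem symmPower_apply_eq_one
    (hρm : ∀ (g : G) (i j : Fin (m + 1)),
      ((ρm g : GL (Fin (m + 1)) A) : Matrix (Fin (m + 1)) (Fin (m + 1)) A) i j =
        coeff (single 0 (m - i) + single 1 (i : ℕ))
          (bind₁ (fun i : Fin 2 => ∑ k : Fin 2,
              C (((ρ g : GL (Fin 2) A) : Matrix (Fin 2) (Fin 2) A) k i) * X k)
            (X 0 ^ (m - j) * X 1 ^ (j : ℕ))))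
    {g : G} (h : ρ g = 1) : ρm g = 1 := by
  classical
  let S : Matrix (Fin 2) (Fin 2) A → Matrix (Fin (m + 1)) (Fin (m + 1)) A := fun g =>
    Matrix.of fun i j => coeff (single 0 (m - i) + single 1 (i : ℕ))
      (bind₁ (fun i : Fin 2 => ∑ k : Fin 2, C (g k i) * X k) (X 0 ^ (m - j) * X 1 ^ (j : ℕ)))
  have hS : ∀ g i j, S g i j = coeff (single 0 (m - i) + single 1 (i : ℕ))
      (bind₁ (fun i : Fin 2 => ∑ k : Fin 2, C (g k i) * X k) (X 0 ^ (m - j) * X 1 ^ (j : ℕ))) :=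
    fun _ _ _ => rfl
  apply Units.ext
  have e : ((ρm g : GL (Fin (m + 1)) A) : Matrix (Fin (m + 1)) (Fin (m + 1)) A) =
      S ((ρ g : GL (Fin 2) A) : Matrix (Fin 2) (Fin 2) A) := by
    ext i j; rw [hρm, hS]
  rw [e, h, Units.val_one, Units.val_one, S_one hS]

/-- **`χ_{(Sym^m ρ)(g)} = ∏_{j=0}^{m} (X - a^{m-j} b^{j})`** when `χ_{ρ(g)} = (X - a)(X - b)` (field
coefficients; `charpoly_S_eq_prod`). [cite: SerreLinearRepresentations1977, §1.5] -/
theorem charpoly_symmPower_eq_prod {G : Type*} [Group G] [TopologicalSpace G] {F : Type*} [Field F]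
    [TopologicalSpace F] {m : ℕ} {ρ : FramedRep G F 2} {ρm : FramedRep G F (m + 1)}
    (hρm : ∀ (g : G) (i j : Fin (m + 1)),
      ((ρm g : GL (Fin (m + 1)) F) : Matrix (Fin (m + 1)) (Fin (m + 1)) F) i j =
        coeff (single 0 (m - i) + single 1 (i : ℕ))
          (bind₁ (fun i : Fin 2 => ∑ k : Fin 2,
              C (((ρ g : GL (Fin 2) F) : Matrix (Fin 2) (Fin 2) F) k i) * X k)
            (X 0 ^ (m - j) * X 1 ^ (j : ℕ))))
    {g : G} {a b : F}
    (hg : FramedRep.charpoly ρ g = (Polynomial.X - Polynomial.C a) * (Polynomial.X - Polynomial.C b)) :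
    FramedRep.charpoly ρm g =
      ∏ j : Fin (m + 1), (Polynomial.X - Polynomial.C (a ^ (m - j) * b ^ (j : ℕ))) := by
  classical
  let S : Matrix (Fin 2) (Fin 2) F → Matrix (Fin (m + 1)) (Fin (m + 1)) F := fun g =>
    Matrix.of fun i j => coeff (single 0 (m - i) + single 1 (i : ℕ))
      (bind₁ (fun i : Fin 2 => ∑ k : Fin 2, C (g k i) * X k) (X 0 ^ (m - j) * X 1 ^ (j : ℕ)))
  have hS : ∀ g i j, S g i j = coeff (single 0 (m - i) + single 1 (i : ℕ))
      (bind₁ (fun i : Fin 2 => ∑ k : Fin 2, C (g k i) * X k) (X 0 ^ (m - j) * X 1 ^ (j : ℕ))) :=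
    fun _ _ _ => rfl
  have e : ((ρm g : GL (Fin (m + 1)) F) : Matrix (Fin (m + 1)) (Fin (m + 1)) F) =
      S ((ρ g : GL (Fin 2) F) : Matrix (Fin 2) (Fin 2) F) := by
    ext i j; rw [hρm, hS]
  unfold FramedRep.charpoly at hg ⊢
  rw [e]
  exact charpoly_S_eq_prod hS _ hg

end Rep

/-! ## 9. Galois predicates: unramifiedness and Frobenius polynomials of `Sym^m ρ` -/

section Galois

open scoped NumberField
open IsDedekindDomain Literature.NumberTheory.GaloisRepresentations

variable {K : Type} [Field K] {A : Type*} [CommRing A] [TopologicalSpace A] [IsTopologicalRing A]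
  {m : ℕ} {ρ : FramedGaloisRep K A 2} {ρm : FramedGaloisRep K A (m + 1)}

omit [IsTopologicalRing A] in
/-- **`Sym^m ρ` is unramified wherever `ρ` is.** [cite: SerreAbelianLadic1968, Ch. I §2.1] -/
theorem isUnramifiedAt_symmPower
    (hρm : ∀ (g : Field.absoluteGaloisGroup K) (i j : Fin (m + 1)),
      ((ρm g : GL (Fin (m + 1)) A) : Matrix (Fin (m + 1)) (Fin (m + 1)) A) i j =
        coeff (single 0 (m - i) + single 1 (i : ℕ))
          (bind₁ (fun i : Fin 2 => ∑ k : Fin 2,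
              C (((ρ g : GL (Fin 2) A) : Matrix (Fin 2) (Fin 2) A) k i) * X k)
            (X 0 ^ (m - j) * X 1 ^ (j : ℕ))))
    {v : HeightOneSpectrum (𝓞 K)} (h : ρ.IsUnramifiedAt v) : ρm.IsUnramifiedAt v :=
  fun 𝔓 h𝔓 σ hσ => symmPower_apply_eq_one hρm (h 𝔓 h𝔓 σ hσ)

/-- **Frobenius polynomials of `Sym^m ρ`** (field coefficients): `χ_ρ(Frob_v) = (X - a)(X - b)` gives
`χ_{Sym^m ρ}(Frob_v) = ∏_{j=0}^{m} (X - a^{m-j} b^{j})`. [cite: SerreLinearRepresentations1977, §1.5] -/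
theorem hasFrobCharpolyAt_symmPower {F : Type*} [Field F] [TopologicalSpace F] [IsTopologicalRing F]
    {ρ : FramedGaloisRep K F 2} {ρm : FramedGaloisRep K F (m + 1)}
    (hρm : ∀ (g : Field.absoluteGaloisGroup K) (i j : Fin (m + 1)),
      ((ρm g : GL (Fin (m + 1)) F) : Matrix (Fin (m + 1)) (Fin (m + 1)) F) i j =
        coeff (single 0 (m - i) + single 1 (i : ℕ))
          (bind₁ (fun i : Fin 2 => ∑ k : Fin 2,
              C (((ρ g : GL (Fin 2) F) : Matrix (Fin 2) (Fin 2) F) k i) * X k)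
            (X 0 ^ (m - j) * X 1 ^ (j : ℕ))))
    {v : HeightOneSpectrum (𝓞 K)} {a b : F}
    (h : ρ.HasFrobCharpolyAt v ((Polynomial.X - Polynomial.C a) * (Polynomial.X - Polynomial.C b))) :
    ρm.HasFrobCharpolyAt v
      (∏ j : Fin (m + 1), (Polynomial.X - Polynomial.C (a ^ (m - j) * b ^ (j : ℕ)))) :=
  fun 𝔓 h𝔓 σ hσ => charpoly_symmPower_eq_prod hρm (h 𝔓 h𝔓 σ hσ)

end Galois

/-! ## 10. Satake side: `arithFrobPolyOfSatake ι q 1` of a pair and of its symmetric power -/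

section Satake

open scoped NumberField
open IsDedekindDomain Literature.NumberTheory.Automorphic Literature.NumberTheory.GaloisRepresentations

variable {ℓ : ℕ} [Fact ℓ.Prime]

/-- `arithFrobPolyOfSatake ι q 1 {x, y} = (X - ι⁻¹(x⁻¹)) (X - ι⁻¹(y⁻¹))`. [folklore] -/
theorem arithFrobPolyOfSatake_one_pair (ι : PadicAlgCl ℓ ≃+* ℂ) (q : ℕ) (x y : ℂ) :
    arithFrobPolyOfSatake ι q 1 {x, y} =
      (Polynomial.X - Polynomial.C (ι.symm x⁻¹)) * (Polynomial.X - Polynomial.C (ι.symm y⁻¹)) := by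
  rw [arithFrobPolyOfSatake_one_eq_prod_map]
  simp

/-- **The predicted Frobenius polynomial of the symmetric-power Satake parameter**
`Sym^m {x, y} = {x^{m-j} y^{j} : j = 0, …, m}`: it is `∏_j (X - x'^{m-j} y'^{j})` for `x' = ι⁻¹(x⁻¹)`,
`y' = ι⁻¹(y⁻¹)` (the dictionary is multiplicative). [cite: BuzzardGeeLMS2014, §2.1] -/
theorem arithFrobPolyOfSatake_one_symmPower (ι : PadicAlgCl ℓ ≃+* ℂ) (q m : ℕ) (x y : ℂ) :
    arithFrobPolyOfSatake ι q 1 ((Multiset.range (m + 1)).map fun j => x ^ (m - j) * y ^ j) =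
      ∏ j : Fin (m + 1), (Polynomial.X -
        Polynomial.C ((ι.symm x⁻¹) ^ (m - j) * (ι.symm y⁻¹) ^ (j : ℕ))) := by
  rw [arithFrobPolyOfSatake_one_eq_prod_map, Multiset.map_map, Multiset.map_map,
    Fin.prod_univ_eq_prod_range (fun j => Polynomial.X -
      Polynomial.C ((ι.symm x⁻¹) ^ (m - j) * (ι.symm y⁻¹) ^ j)) (m + 1),
    Finset.prod_eq_multiset_prod, Finset.range_val]
  congr 1
  refine Multiset.map_congr rfl fun j _ => ?_
  simp only [Function.comp_apply]
  rw [mul_inv, ← inv_pow, ← inv_pow, map_mul, map_pow, map_pow]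

end Satake

section SatakeRep

open scoped NumberField
open IsDedekindDomain Literature.NumberTheory.Automorphic Literature.NumberTheory.GaloisRepresentations

/-- **Symmetric power of a Satake-compatible avatar.**  If the arithmetic Frobenii at `v` have
characteristic polynomial `arithFrobPolyOfSatake ι q 1 {x, y}` on `ρ`, then on `Sym^m ρ` they have
characteristic polynomial `arithFrobPolyOfSatake ι q 1 (Sym^m {x, y})`,
`Sym^m {x, y} = {x^{m-j} y^{j}}` — the unramified local symmetric-power functoriality
`GL_2 → GL_{m+1}` on the Galois side. [cite: BuzzardGeeLMS2014, §2.1]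
[cite: SerreLinearRepresentations1977, §1.5] -/
theorem hasFrobCharpolyAt_symmPower_arithFrobPolyOfSatake {ℓ : ℕ} [Fact ℓ.Prime] {K : Type} [Field K]
    {m : ℕ} {ρ : FramedGaloisRep K (PadicAlgCl ℓ) 2} {ρm : FramedGaloisRep K (PadicAlgCl ℓ) (m + 1)}
    (hρm : ∀ (g : Field.absoluteGaloisGroup K) (i j : Fin (m + 1)),
      ((ρm g : GL (Fin (m + 1)) (PadicAlgCl ℓ)) : Matrix (Fin (m + 1)) (Fin (m + 1)) (PadicAlgCl ℓ)) i j =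
        coeff (single 0 (m - i) + single 1 (i : ℕ))
          (bind₁ (fun i : Fin 2 => ∑ k : Fin 2,
              C (((ρ g : GL (Fin 2) (PadicAlgCl ℓ)) : Matrix (Fin 2) (Fin 2) (PadicAlgCl ℓ)) k i) * X k)
            (X 0 ^ (m - j) * X 1 ^ (j : ℕ))))
    (ι : PadicAlgCl ℓ ≃+* ℂ) {v : HeightOneSpectrum (𝓞 K)} (q : ℕ) {x y : ℂ}
    (h : ρ.HasFrobCharpolyAt v (arithFrobPolyOfSatake ι q 1 {x, y})) :
    ρm.HasFrobCharpolyAt v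
      (arithFrobPolyOfSatake ι q 1 ((Multiset.range (m + 1)).map fun j => x ^ (m - j) * y ^ j)) := by
  rw [arithFrobPolyOfSatake_one_symmPower]
  rw [arithFrobPolyOfSatake_one_pair] at h
  exact hasFrobCharpolyAt_symmPower hρm h

end SatakeRep

end Summit.Langlands.Langlands.Theorems.IrreducibleOffSector

end
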